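import Mathlib.GroupTheory.Index
import Mathlib.GroupTheory.Nilpotent
import Mathlib.Data.Nat.Factorization.Basic
import Summits.MatrixMultiplication.OmegaCensus.BoxUsefulNilpotent
import Summits.MatrixMultiplication.OmegaCensus.BoxBad2Groups

/-!
# ω-census, family (b3): conjecture C9 (b) HOLDS on every finite nilpotent group

HONEST FRAMING (pub-omega census; verbatim): lottery ticket; floor = certified bounds/negative ranges.
Census BOOKKEEPING (conjecture C9 of the cell, STRUCTURE.md §2; pub-omega kernel-l4 gen 15, task K-4 — closing the nilpotent class).
`BoxUsefulNilpotent` showed that in a box-useful finite nilpotent group every element of odd order is central; `BoxBad2Groups` showed that a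
box-useful `2`-group has centre of index `≤ 4`.  Here the two are joined: with `P` the Sylow `2`-subgroup, every `g` factors as `p ζ`
(`p ∈ P`, `ζ` central — Bézout on the order of `g`), so `G = P·Z(G)`, `Z(P) = Z(G) ∩ P` and `[G : Z(G)] = [P : Z(P)] ≤ 4`:
**`index_center_le_four_of_isNilpotent`** — C9 (b) for every finite nilpotent group (abelian, or centre of index `4`; the law's other
escapes do not occur), and `boxRatioSectionLaw_of_isNilpotent` in the shape of the conjecture.  Nothing here is progress on `ω`.
-/

namespace Summit.MatrixMultiplication.OmegaCensus

open Finset ProductBoxBound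

namespace TwoGroup

universe u

variable {G : Type u} [Group G] [Fintype G] [DecidableEq G]

/-- In a box-useful nilpotent group every element is (Sylow-`2` element) × (central element). [folklore] -/
theorem exists_sylow_mul_central [Group.IsNilpotent G] (hG : BoxUseful G) (P : Sylow 2 G) (g : G) :
    ∃ p ∈ (P : Subgroup G), ∃ ζ ∈ Subgroup.center G, g = p * ζ := by
  classical
  haveI : Fact (Nat.Prime 2) := ⟨Nat.prime_two⟩
  obtain ⟨k, m, hm, hn⟩ := Nat.exists_eq_two_pow_mul_odd (orderOf_pos g).ne'
  have h2k : (2 : ℕ) ^ k ≠ 0 := pow_ne_zero _ two_ne_zero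
  -- `y = g^(2^k)` has odd order `m`, hence is central
  have hy : Odd (orderOf (g ^ 2 ^ k)) := by
    rw [orderOf_pow' g h2k, hn, Nat.gcd_eq_right (Dvd.intro m rfl), Nat.mul_div_cancel_left m (Nat.pos_of_ne_zero h2k)]
    exact hm
  have hyc : g ^ 2 ^ k ∈ Subgroup.center G := BoxNilpotent.mem_center_of_odd_orderOf hG hy
  -- `x = g^m` is a `2`-element, hence lies in the (unique, normal) Sylow `2`-subgroup
  have hxpow : (g ^ m) ^ 2 ^ k = 1 := by rw [← pow_mul, mul_comm, ← hn]; exact pow_orderOf_eq_one g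
  have hxP : g ^ m ∈ (P : Subgroup G) := by
    have hdvd : orderOf (g ^ m) ∣ 2 ^ k := orderOf_dvd_of_pow_eq_one hxpow
    obtain ⟨j, -, hj⟩ := (Nat.dvd_prime_pow Nat.prime_two).1 hdvd
    have hH : IsPGroup 2 (Subgroup.zpowers (g ^ m)) := IsPGroup.of_card (by rw [Nat.card_zpowers, hj])
    obtain ⟨Q, hQ⟩ := hH.exists_le_sylow
    have hQP : Q = P := by
      letI := Sylow.unique_of_normal P inferInstance
      exact Subsingleton.elim Q P
    rw [← hQP]
    exact hQ (Subgroup.mem_zpowers _)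
  -- Bézout: `2^k a + m b = 1`
  have hcop : Nat.Coprime (2 ^ k) m :=
    Nat.Coprime.pow_left k ((Nat.Prime.coprime_iff_not_dvd Nat.prime_two).mpr hm.not_two_dvd_nat)
  have hbez : ((2 ^ k : ℕ) : ℤ) * Nat.gcdA (2 ^ k) m + (m : ℤ) * Nat.gcdB (2 ^ k) m = 1 := by
    rw [← Nat.gcd_eq_gcd_ab, Nat.Coprime.gcd_eq_one hcop]; rfl
  refine ⟨(g ^ m) ^ Nat.gcdB (2 ^ k) m, Subgroup.zpow_mem _ hxP _, (g ^ 2 ^ k) ^ Nat.gcdA (2 ^ k) m,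
    Subgroup.zpow_mem _ hyc _, ?_⟩
  have hcomm : (g ^ 2 ^ k) ^ Nat.gcdA (2 ^ k) m * (g ^ m) ^ Nat.gcdB (2 ^ k) m =
      (g ^ m) ^ Nat.gcdB (2 ^ k) m * (g ^ 2 ^ k) ^ Nat.gcdA (2 ^ k) m :=
    (Subgroup.mem_center_iff.mp (Subgroup.zpow_mem _ hyc _) _).symm
  calc g = g ^ (1 : ℤ) := (zpow_one g).symm
    _ = g ^ (((2 ^ k : ℕ) : ℤ) * Nat.gcdA (2 ^ k) m + (m : ℤ) * Nat.gcdB (2 ^ k) m) := by rw [hbez]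
    _ = (g ^ 2 ^ k) ^ Nat.gcdA (2 ^ k) m * (g ^ m) ^ Nat.gcdB (2 ^ k) m := by
        rw [zpow_add, zpow_mul, zpow_mul, zpow_natCast, zpow_natCast]
    _ = (g ^ m) ^ Nat.gcdB (2 ^ k) m * (g ^ 2 ^ k) ^ Nat.gcdA (2 ^ k) m := hcomm

/-- `G = P · Z(G)`. [folklore] -/
theorem sylow_sup_center_eq_top [Group.IsNilpotent G] (hG : BoxUseful G) (P : Sylow 2 G) :
    (P : Subgroup G) ⊔ Subgroup.center G = ⊤ := by
  rw [eq_top_iff]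
  intro g _
  obtain ⟨p, hp, ζ, hζ, rfl⟩ := exists_sylow_mul_central hG P g
  exact Subgroup.mul_mem _ (Subgroup.mem_sup_left hp) (Subgroup.mem_sup_right hζ)

/-- `Z(G) ∩ P = Z(P)`. [folklore] -/
theorem center_subgroupOf_sylow [Group.IsNilpotent G] (hG : BoxUseful G) (P : Sylow 2 G) :
    (Subgroup.center G).subgroupOf (P : Subgroup G) = Subgroup.center (P : Subgroup G) := by
  ext ⟨x, hx⟩
  rw [Subgroup.mem_subgroupOf, Subgroup.mem_center_iff, Subgroup.mem_center_iff]
  constructor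
  · intro h q
    exact Subtype.ext (h q)
  · intro h g
    obtain ⟨p, hp, ζ, hζ, rfl⟩ := exists_sylow_mul_central hG P g
    have hpx : p * x = x * p := congrArg Subtype.val (h ⟨p, hp⟩)
    have hζx : ζ * x = x * ζ := Subgroup.mem_center_iff.mp hζ x |>.symm
    change p * ζ * x = x * (p * ζ)
    rw [mul_assoc, hζx, ← mul_assoc, hpx, mul_assoc]

/-- **C9 (b) holds on every finite nilpotent group**: a box-useful one has centre of index at most `4`. [folklore] -/
theorem index_center_le_four_of_isNilpotent [Group.IsNilpotent G] (hG : BoxUseful G) : (Subgroup.center G).index ≤ 4 := by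
  classical
  haveI : Fact (Nat.Prime 2) := ⟨Nat.prime_two⟩
  obtain ⟨P⟩ : Nonempty (Sylow 2 G) := inferInstance
  haveI : Fintype (P : Subgroup G) := Fintype.ofFinite _
  have hP : (Subgroup.center (P : Subgroup G)).index ≤ 4 :=
    index_center_le_four_of_isPGroup_two P.isPGroup' (hG.subgroup (P : Subgroup G))
  have e : (Subgroup.center G).index = (Subgroup.center (P : Subgroup G)).index := by
    rw [← Subgroup.relIndex_top_right, ← sylow_sup_center_eq_top hG P, Subgroup.relIndex_sup_right,
      Subgroup.relIndex, center_subgroupOf_sylow hG P]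
  rw [e]; exact hP

/-- **C9 (b) in the shape of `BoxRatioSectionLaw`** for nilpotent groups (same disjunction as `boxRatioSectionLaw_of_isPGroup_odd`). [folklore] -/
theorem boxRatioSectionLaw_of_isNilpotent [Group.IsNilpotent G] (h : BoxUseful G) :
    (Subgroup.center G).index = 1 ∨ (Subgroup.center G).index = 4 ∨ (Subgroup.center G).index = 6 ∨
      ∃ (c₁ c₂ : G) (κ₁ κ₂ ε : G → ZMod 3), DihC3Sq.Coord2 c₁ c₂ κ₁ κ₂ ε := by
  have h4 := index_center_le_four_of_isNilpotent h
  have hpos : 0 < (Subgroup.center G).index := Nat.pos_of_ne_zero Subgroup.index_ne_zero_of_finite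
  by_cases h1 : (Subgroup.center G).index = 1
  · exact Or.inl h1
  by_cases h4' : (Subgroup.center G).index = 4
  · exact Or.inr (Or.inl h4')
  exfalso
  have h23 : (Subgroup.center G).index = 2 ∨ (Subgroup.center G).index = 3 := by omega
  have comm : ∀ x y : G, x * y = y * x := by
    rcases h23 with e | e
    · haveI : Fact (Nat.Prime 2) := ⟨Nat.prime_two⟩
      exact comm_of_index_center_prime e
    · haveI : Fact (Nat.Prime 3) := ⟨Nat.prime_three⟩
      exact comm_of_index_center_prime e
  apply h1
  rw [Subgroup.index_eq_one, eq_top_iff]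
  intro x _
  rw [Subgroup.mem_center_iff]; intro g; exact comm g x

end TwoGroup

end Summit.MatrixMultiplication.OmegaCensus
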